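import Mathlib
import Summits.KontsevichZagierPeriods.KontsevichZagierPeriods.Theorems.SoloInformedTorsionMaster
import Summits.KontsevichZagierPeriods.KontsevichZagierPeriods.Theorems.SoloInformedTriplingMap
import HarnessLib
import HarnessLib.Audit

/-!
# SoloInformed — the torsion chain, IV: the tripling move `⟦M₃|_{piece}⟧ = ⟦M₁⟧`

The multiplication-by-`3` map `σ` of `E : y² = X³ + 1` in the coordinate `w = 1/(X + 2)`
(`SoloInformedTriplingMap`) is `3 : 1` on `(0,1)`, monotone on each of `(0,¼)`, `(¼,½)`,
`(½,1)` and mapping each onto `(0,1)`. Since `[3]^*(dX/y) = 3·dX/y`, i.e.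
`σ^{−1/2} Q(σ)^{−1/2} |σ'| = 3 · w^{−1/2} Q(w)^{−1/2}` (from the key identity
`σ'² · wQ(w) = 9 σQ(σ)` by taking square roots — the sign of `σ'` is never needed),
Kontsevich–Zagier's rule 2 along `σ` identifies every monotonicity piece of the master
representation `M₃ = [(0,1), 3w^{−1/2}Q^{−1/2}]` with `M₁ = [(0,1), w^{−1/2}Q^{−1/2}]`:
`soloInformed_tripling_lift_mem_changeOfVariablesRel`. Injectivity on a piece is Rolle
(`σ' ≠ 0` because the right-hand side of the key identity is positive) and surjectivity is the
intermediate value theorem between torsion values (`soloInformed_Ioo_substitution`).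
Residency `solo-KontsevichZagierPeriods-informed` (s23); paper §6octies (vii).

References: Kontsevich–Zagier, *Periods* (2001), §1.2, rule 2; J. H. Silverman, *The Arithmetic
of Elliptic Curves*, III.5.1 (`[m]^*ω = mω`).
-/

noncomputable section

open MeasureTheory Set Filter
namespace Summit.KontsevichZagierPeriods.KontsevichZagierPeriods.Theorems

open Literature.NumberTheory.Transcendental Literature.NumberTheory.Transcendental.KZ
open Literature.ModelTheory.ExponentialFields

/-! ### The integrand identity `3 w^{−1/2}Q(w)^{−1/2} = σ^{−1/2}Q(σ)^{−1/2}|σ'|` -/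

/-- **Integrand identity of the tripling move**: for `w ∈ (0,1)` with `σ(w) ∈ (0,1)`,
`3 · w^{−1/2} Q(w)^{−1/2} = σ^{−1/2} Q(σ)^{−1/2} · |σ'(w)|` (squares + the key identity).
[Silverman, AEC III.5.1; this work] -/
theorem soloInformed_tripling_identity {w : ℝ} (h0 : 0 < w) (h1 : w < 1)
    (hσ : soloInformedTripling w ∈ Ioo (0:ℝ) 1) :
    ((3 : ℚ) : ℝ) * (w ^ (-1 / 2 : ℝ) * soloInformedTorsionQ w ^ (-1 / 2 : ℝ)) =
      ((1 : ℚ) : ℝ) * (soloInformedTripling w ^ (-1 / 2 : ℝ) *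
        soloInformedTorsionQ (soloInformedTripling w) ^ (-1 / 2 : ℝ)) *
          |soloInformedTripling' w| := by
  have hsq : ∀ {x : ℝ}, 0 < x → (x ^ (-1 / 2 : ℝ)) ^ 2 = x⁻¹ := fun {x} hx => by
    rw [← Real.rpow_natCast (x ^ (-1 / 2 : ℝ)) 2, ← Real.rpow_mul hx.le]
    norm_num
    exact Real.rpow_neg_one x
  have hQ := soloInformed_torsionQ_pos h1
  have hQσ := soloInformed_torsionQ_pos hσ.2
  have hσ0 := hσ.1
  have hD : soloInformedTriplingDen w ≠ 0 := (soloInformed_triplingDen_pos h0.le h1.le).ne'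
  have hk : soloInformedTripling' w ^ 2 * (w * soloInformedTorsionQ w) =
      9 * (soloInformedTripling w * soloInformedTorsionQ (soloInformedTripling w)) :=
    soloInformed_tripling_key hD
  push_cast
  rw [one_mul, ← pow_left_inj₀ (by positivity) (by positivity) two_ne_zero]
  simp only [mul_pow, sq_abs]
  rw [hsq h0, hsq hQ, hsq hσ0, hsq hQσ]
  have hw : w ≠ 0 := h0.ne'
  have hQ' := hQ.ne'
  have hσ' := hσ0.ne'
  have hQσ' := hQσ.ne'
  field_simp
  linear_combination (-1 : ℝ) * hk

/-- The lift of `σ` is a `ℚ`-semialgebraic map on any semialgebraic set inside `[0,1]`.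
[this work] -/
theorem soloInformed_isSemialgebraicMapOn_lift_tripling {D : Set (Fin 1 → ℝ)}
    (hD : IsSemialgebraic ℚ D) (hD01 : ∀ x ∈ D, 0 ≤ x 0 ∧ x 0 ≤ 1) :
    IsSemialgebraicMapOn ℚ D (soloInformedLift soloInformedTripling) := by
  refine IsSemialgebraicMapOn.of_forall hD fun j => ?_
  refine (isSemialgebraicFunOn_aeval_div_aeval hD
    (MvPolynomial.C 9 * MvPolynomial.X 0 * (1 - MvPolynomial.C 2 * MvPolynomial.X 0) ^ 2 *
      ((1 - MvPolynomial.C 2 * MvPolynomial.X 0) ^ 3 +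
        MvPolynomial.C 4 * MvPolynomial.X 0 ^ 3) ^ 2)
    ((1 - MvPolynomial.X 0) * (1 - MvPolynomial.C 4 * MvPolynomial.X 0) ^ 2 *
      ((1 - MvPolynomial.C 2 * MvPolynomial.X 0) ^ 2 * (1 + MvPolynomial.C 4 * MvPolynomial.X 0) +
        MvPolynomial.C 4 * MvPolynomial.X 0 ^ 3) ^ 2 +
      MvPolynomial.C 9 * MvPolynomial.X 0 * (1 - MvPolynomial.C 2 * MvPolynomial.X 0) ^ 2 *
      ((1 - MvPolynomial.C 2 * MvPolynomial.X 0) ^ 3 +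
        MvPolynomial.C 4 * MvPolynomial.X 0 ^ 3) ^ 2)
    fun x hx => ?_).congr fun x hx => ?_
  · have h := (soloInformed_triplingDen_pos (hD01 x hx).1 (hD01 x hx).2).ne'
    unfold soloInformedTriplingDen soloInformedTriplingA soloInformedTriplingP at h
    simpa using h
  · simp [soloInformedLift, soloInformedTripling, soloInformedTriplingDen,
      soloInformedTriplingA, soloInformedTriplingP]

/-! ### The move on one monotonicity piece -/

/-- **The tripling move on one monotonicity piece (rule 2).** If `(a,b) ⊆ (0,1)` is mapped by
`σ` into `(0,1)` with `{σ(a), σ(b)} = {0, 1}`, then for every representation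
`R = [(a,b), 3w^{−1/2}Q^{−1/2}]` (a piece of `M₃`): `[R] − [M₁] ∈ changeOfVariablesRel` —
each piece of `∫ 3·dX/y` is a copy of `∫ dX/y`. [Kontsevich–Zagier 2001, §1.2; this work] -/
theorem soloInformed_tripling_lift_mem_changeOfVariablesRel {a b : ℝ} (hab : a ≤ b)
    (ha : 0 ≤ a) (hb : b ≤ 1) (hmaps : MapsTo soloInformedTripling (Ioo a b) (Ioo 0 1))
    (hends : (soloInformedTripling a = 0 ∧ soloInformedTripling b = 1) ∨
      (soloInformedTripling a = 1 ∧ soloInformedTripling b = 0))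
    (R : IntegralRep 1) (hRd : R.domain = {x | x 0 ∈ Ioo a b})
    (hRi : EqOn R.integrand (soloInformedTorsionFun 3) R.domain) :
    of R - of (soloInformedTorsionRep 1) ∈ changeOfVariablesRel := by
  have hIoo : ∀ t ∈ Ioo a b, 0 < t ∧ t < 1 := fun t ht =>
    ⟨lt_of_le_of_lt ha ht.1, lt_of_lt_of_le ht.2 hb⟩
  have hcont : ContinuousOn soloInformedTripling (Icc a b) :=
    soloInformed_continuousOn_tripling.mono (Icc_subset_Icc ha hb)
  have hder : ∀ t ∈ Ioo a b, HasDerivAt soloInformedTripling (soloInformedTripling' t) t :=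
    fun t ht => soloInformed_hasDerivAt_tripling
      (soloInformed_triplingDen_pos (hIoo t ht).1.le (hIoo t ht).2.le).ne'
  have hsub := soloInformed_Ioo_substitution hab hcont hder
    (fun t ht => soloInformed_tripling'_ne_zero (hIoo t ht).1 (hIoo t ht).2 (hmaps ht))
    hmaps hends
  refine soloInformed_lift_mem_changeOfVariablesRel R (soloInformedTorsionRep 1) hRd rfl ?_
    hder hsub.1 hsub.2 fun x hx => ?_
  · rw [hRd]
    exact soloInformed_isSemialgebraicMapOn_lift_tripling (hRd ▸ R.isSemialgebraic_domain)
      fun x hx => by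
        have hx' : a < x 0 ∧ x 0 < b := hx
        exact ⟨(hIoo _ hx').1.le, (hIoo _ hx').2.le⟩
  · have hx' : a < x 0 ∧ x 0 < b := by rw [hRd] at hx; exact hx
    rw [hRi hx]
    dsimp only [soloInformedLift, soloInformedTorsionFun, soloInformedTorsionRep]
    exact soloInformed_tripling_identity (hIoo _ hx').1 (hIoo _ hx').2 (hmaps hx')

/-! ### The three pieces of `M₃` -/

/-- The slab `(0,¼)` is semialgebraic. [folklore] -/
theorem soloInformed_isSemialgebraic_firstQuarter :
    IsSemialgebraic ℚ {t : Fin 1 → ℝ | t 0 ∈ Ioo (0:ℝ) (1 / 4)} :=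
  soloInformed_isSemialgebraic_slab ⟨0, by norm_num⟩ ⟨1 / 4, by norm_num⟩

/-- The slab `(¼,½)` is semialgebraic. [folklore] -/
theorem soloInformed_isSemialgebraic_secondQuarter :
    IsSemialgebraic ℚ {t : Fin 1 → ℝ | t 0 ∈ Ioo (1 / 4 : ℝ) (1 / 2)} :=
  soloInformed_isSemialgebraic_slab ⟨1 / 4, by norm_num⟩ ⟨1 / 2, by norm_num⟩

/-- **Piece `(0,¼)`** of `M₃` (restricted from any `R ⊇ (0,¼)` with the `M₃` integrand) is a
copy of `M₁`: `σ(0) = 0`, `σ(¼) = 1`. [this work] -/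
theorem soloInformed_tripling_piece₁ (R : IntegralRep 1)
    (hRi : EqOn R.integrand (soloInformedTorsionFun 3) R.domain)
    (h₁ : {t : Fin 1 → ℝ | t 0 ∈ Ioo (0:ℝ) (1 / 4)} ⊆ R.domain) :
    toFormalPeriod (of (R.restrict _ soloInformed_isSemialgebraic_firstQuarter h₁)) =
      toFormalPeriod (of (soloInformedTorsionRep 1)) :=
  toFormalPeriod_eq_iff.mpr (changeOfVariablesRel_subset_relations
    (soloInformed_tripling_lift_mem_changeOfVariablesRel (by norm_num) le_rfl (by norm_num)
      soloInformed_tripling_mapsTo₁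
      (Or.inl ⟨soloInformed_tripling_values.1, soloInformed_tripling_values.2.1⟩) _ rfl
      fun _ hx => hRi (h₁ hx)))

/-- **Piece `(¼,½)`** of `M₃` is a copy of `M₁`: `σ(¼) = 1`, `σ(½) = 0` (decreasing branch).
[this work] -/
theorem soloInformed_tripling_piece₂ (R : IntegralRep 1)
    (hRi : EqOn R.integrand (soloInformedTorsionFun 3) R.domain)
    (h₂ : {t : Fin 1 → ℝ | t 0 ∈ Ioo (1 / 4 : ℝ) (1 / 2)} ⊆ R.domain) :
    toFormalPeriod (of (R.restrict _ soloInformed_isSemialgebraic_secondQuarter h₂)) =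
      toFormalPeriod (of (soloInformedTorsionRep 1)) :=
  toFormalPeriod_eq_iff.mpr (changeOfVariablesRel_subset_relations
    (soloInformed_tripling_lift_mem_changeOfVariablesRel (by norm_num) (by norm_num)
      (by norm_num) soloInformed_tripling_mapsTo₂
      (Or.inr ⟨soloInformed_tripling_values.2.1, soloInformed_tripling_values.2.2.1⟩) _ rfl
      fun _ hx => hRi (h₂ hx)))

/-- **Piece `(½,1)`** of `M₃` is a copy of `M₁`: `σ(½) = 0`, `σ(1) = 1`. [this work] -/
theorem soloInformed_tripling_piece₃ (R : IntegralRep 1)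
    (hRi : EqOn R.integrand (soloInformedTorsionFun 3) R.domain)
    (hU : {t : Fin 1 → ℝ | t 0 ∈ Ioo (1 / 2 : ℝ) 1} ⊆ R.domain) :
    toFormalPeriod (of (R.restrict _ soloInformed_isSemialgebraic_upperHalf hU)) =
      toFormalPeriod (of (soloInformedTorsionRep 1)) :=
  toFormalPeriod_eq_iff.mpr (changeOfVariablesRel_subset_relations
    (soloInformed_tripling_lift_mem_changeOfVariablesRel (by norm_num) (by norm_num) le_rfl
      soloInformed_tripling_mapsTo₃
      (Or.inl ⟨soloInformed_tripling_values.2.2.1, soloInformed_tripling_values.2.2.2⟩) _ rfl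
      fun _ hx => hRi (hU hx)))

end Summit.KontsevichZagierPeriods.KontsevichZagierPeriods.Theorems

end
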